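import Literature.MathematicalPhysics.QuantumLattice.SpinFlippedStatesStaggeredOrderCoexistence
import HarnessLib

/-!
# Staggered order from two even boxes: the end-to-end certificate

One theorem for the certified-numerics cells: feed a certified LOWER bound `ℓ₀ ≤ log Re Tr e^{−βH_N(a, 0)}` (Hubbard model, chemical potential
`μ = −a`, no staggered field) and a certified UPPER bound `log Re Tr e^{−βH_N(a, δ)} ≤ u₁` (staggered-field coefficient `δ > 0`) on ONE even box
`[0,N)^d`, and obtain, for EVERY `(2ℤ)^d`-periodic equilibrium state `ω` of the zero-field Hubbard model at inverse temperature `β > 0`,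

  `|m_s(ω)| ≤ [ (u₁ − ℓ₀)/N^d + |β|·col_1(N)·(S₀ + S₁)/N^d ] / (βδ)`

(`col_1(N) = |thicken_1([0,N)^d) ∖ [0,N)^d|`, `S₀, S₁` the cell site norms of the two interactions) — `abs_staggeredMagnetisation_le_of_evenBoxes`.
Ingredients: the floor / cap of `PeriodicGibbsVariationalPrinciple` / `PeriodicVariationalPressure`, the symmetric Griffiths window of
`StaggeredMagnetisationSpinFlipBound`, and `(hubbardStaggered).Φ ∅ = 0`. Also the cell-averaged DENSITY window from three even boxes
(`cellDensity_mem_Icc_of_evenBoxes`).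

Everything is PROVED; no definition, no named fact, no number. HONEST SCOPE: the right-hand side is only small when `N^{-d}(u₁ − ℓ₀)` resolves
the pressure difference `P(a,δ) − P(a,0) = O(δ²)` — i.e. for `δ` not too small against the box precision; no claim that any bound `< 1` has been
computed.

## Tree / Mathlib search

REUSED: `hubbardStaggered(_structure)`, `evenPeriods`, `staggeredMagnetisation`, `IsPerVarEquilibrium.cellDensity_mem_Icc_hubbardStaggered`
(`PeriodicSublatticeAndStaggeredTerms`); `IsPerVarEquilibrium.abs_staggeredMagnetisation_le_of_bounds` (`StaggeredMagnetisationSpinFlipBound`);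
`le_perVarPressure_of_le_log_partitionFn` (`PeriodicGibbsVariationalPrinciple`); `perVarPressure_le_of_log_partitionFn_le` (`PeriodicVariationalPressure`);
`IsPerVarEquilibrium.cellMeanEnergy_mem_Icc_of_bounds` (`PeriodicVariationalEquilibria`).

## References

* R. B. Griffiths, J. Math. Phys. 5 (1964) 1215, Eq. (39) and Fig. 3.
* R. B. Israel, *Convexity in the Theory of Lattice Gases* (1979), Lemma II.3.1, Thm. I.2.4.
-/

noncomputable section

open scoped ComplexOrder BigOperators
open Finset Filter Topology

namespace Literature.MathematicalPhysics.QuantumLattice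

open Matrix HubbardWave0 Literature.Probability.LatticeModels ThermodynamicLimit

variable {d : ℕ}

/-- The staggered-field Hubbard interaction has no constant term: `Ψ(∅) = 0`. [cite: ArakiMoriya2003, §5.1] -/
theorem hubbardStaggered_apply_empty (t U : ℝ) (θ : Fin 2 → ℝ) : (hubbardStaggered d t U θ).Φ ∅ = 0 := by
  rw [hubbardStaggered, FermionInteraction.linearFamily_apply]
  simp [hubbardFermionInteraction, numberInteraction, staggeredSpinInteraction]

/-- Hence the constant `β Re(Ψ∅)_{∅∅}` of the box windows vanishes. [cite: ArakiMoriya2003, §5.1] -/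
theorem hubbardStaggered_empty_re (t U : ℝ) (θ : Fin 2 → ℝ) : (((hubbardStaggered d t U θ).Φ ∅) ∅ ∅).re = 0 := by
  rw [hubbardStaggered_apply_empty, Matrix.zero_apply, Complex.zero_re]

namespace InfVolFermionState

variable {β t U a : ℝ} {ω : InfVolFermionState d}

/-- **STAGGERED ORDER FROM TWO EVEN BOXES** (end-to-end): for every `(2ℤ)^d`-periodic equilibrium state `ω` of the zero-field Hubbard model
(`β > 0`, `d ≥ 1`), every `δ > 0` and every even `N ≥ 1`, certified bounds `ℓ₀ ≤ log Re Z_N(a,0)` and `log Re Z_N(a,δ) ≤ u₁` give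
`|m_s(ω)| ≤ ((u₁ − ℓ₀)/N^d + |β| col_1(N) (S₀ + S₁)/N^d)/(βδ)`. [cite: Griffiths1964, Eq. (39) and Fig. 3] [cite: Israel1979, Lemma II.3.1] -/
theorem IsPerVarEquilibrium.abs_staggeredMagnetisation_le_of_evenBoxes (hd : 0 < d) (hβ : 0 < β)
    (h : ω.IsPerVarEquilibrium β (evenPeriods d) (hubbardStaggered d t U ![a, 0]) 1) {δ : ℝ} (hδ : 0 < δ) {N : ℕ} (hN : 1 ≤ N) (hN2 : 2 ∣ N)
    {ℓ₀ u₁ : ℝ} (hℓ : ℓ₀ ≤ Real.log (Matrix.partitionFn β ((hubbardStaggered d t U ![a, 0]).localHamiltonian (halfOpenBox d N))).re)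
    (hu : Real.log (Matrix.partitionFn β ((hubbardStaggered d t U ![a, δ]).localHamiltonian (halfOpenBox d N))).re ≤ u₁) :
    |ω.staggeredMagnetisation| ≤
      ((u₁ - ℓ₀) / (N : ℝ) ^ d +
          |β| * ((((thicken (halfOpenBox d N) 1 \ halfOpenBox d N).card : ℝ)) *
              ((hubbardStaggered d t U ![a, 0]).cellSiteNorm (evenPeriods d) 1 +
                (hubbardStaggered d t U ![a, δ]).cellSiteNorm (evenPeriods d) 1)) / (N : ℝ) ^ d) / (β * δ) := by
  obtain ⟨hH0, hE0, hP0, hR0⟩ := hubbardStaggered_structure (d := d) t U ![a, 0]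
  obtain ⟨hH1, -, hP1, hR1⟩ := hubbardStaggered_structure (d := d) t U ![a, δ]
  have hNq : ∀ i : Fin d, (evenPeriods d i + 1) ∣ N := fun _ => hN2
  have hL := FermionInteraction.le_perVarPressure_of_le_log_partitionFn hd hH0 hE0 hP0 hR0 β hN hNq hℓ
  have hU := FermionInteraction.perVarPressure_le_of_log_partitionFn_le hd hH1 hP1 hR1 β hN hNq hu
  rw [hubbardStaggered_empty_re, mul_zero, add_zero] at hL hU
  refine (h.abs_staggeredMagnetisation_le_of_bounds hd hβ le_rfl hδ hL hU).trans (le_of_eq ?_)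
  congr 1
  ring

/-- **CELL DENSITY FROM THREE EVEN BOXES** (end-to-end, direction `θ₀ = a = −μ`): for every `(2ℤ)^d`-periodic equilibrium state of the
staggered-field Hubbard model at `θ = (a, b)` (`β > 0`, `δ > 0`, even `N ≥ 1`), certified `ℓ ≤ log Re Z_N(a,b)`, `log Re Z_N(a+δ,b) ≤ u₊`,
`log Re Z_N(a−δ,b) ≤ u₋` give the window
`(ℓ − u₊ − |β|col(S + S₊))/(N^d βδ) ≤ 2^{-d} Σ_{c∈{0,1}^d} ρ_c(ω) ≤ (u₋ − ℓ + |β|col(S + S₋))/(N^d βδ)`.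
[cite: Griffiths1964, Eq. (39) and Fig. 3] [cite: Israel1979, Lemma II.3.1] -/
theorem IsPerVarEquilibrium.cellDensity_mem_Icc_of_evenBoxes (hd : 0 < d) (hβ : 0 < β) {θ : Fin 2 → ℝ}
    (h : ω.IsPerVarEquilibrium β (evenPeriods d) (hubbardStaggered d t U θ) 1) {δ : ℝ} (hδ : 0 < δ) {N : ℕ} (hN : 1 ≤ N) (hN2 : 2 ∣ N)
    {ℓ uplus uminus : ℝ} (hℓ : ℓ ≤ Real.log (Matrix.partitionFn β ((hubbardStaggered d t U θ).localHamiltonian (halfOpenBox d N))).re)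
    (hup : Real.log (Matrix.partitionFn β ((hubbardStaggered d t U (θ + Pi.single 0 δ)).localHamiltonian (halfOpenBox d N))).re ≤ uplus)
    (hum : Real.log (Matrix.partitionFn β ((hubbardStaggered d t U (θ + Pi.single 0 (-δ))).localHamiltonian (halfOpenBox d N))).re ≤ uminus) :
    (Fintype.card (Cell (evenPeriods d)) : ℝ)⁻¹ * ∑ c : Cell (evenPeriods d), ω.densityAt (cellPos c) ∈ Set.Icc
      (((ℓ / (N : ℝ) ^ d - |β| * ((((thicken (halfOpenBox d N) 1 \ halfOpenBox d N).card : ℝ)) *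
            (hubbardStaggered d t U θ).cellSiteNorm (evenPeriods d) 1 / (N : ℝ) ^ d)) -
          (uplus / (N : ℝ) ^ d + |β| * ((((thicken (halfOpenBox d N) 1 \ halfOpenBox d N).card : ℝ)) *
            (hubbardStaggered d t U (θ + Pi.single 0 δ)).cellSiteNorm (evenPeriods d) 1) / (N : ℝ) ^ d)) / (β * δ))
      (((uminus / (N : ℝ) ^ d + |β| * ((((thicken (halfOpenBox d N) 1 \ halfOpenBox d N).card : ℝ)) *
            (hubbardStaggered d t U (θ + Pi.single 0 (-δ))).cellSiteNorm (evenPeriods d) 1) / (N : ℝ) ^ d) -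
          (ℓ / (N : ℝ) ^ d - |β| * ((((thicken (halfOpenBox d N) 1 \ halfOpenBox d N).card : ℝ)) *
            (hubbardStaggered d t U θ).cellSiteNorm (evenPeriods d) 1 / (N : ℝ) ^ d))) / (β * δ)) := by
  obtain ⟨hH0, hE0, hP0, hR0⟩ := hubbardStaggered_structure (d := d) t U θ
  obtain ⟨hH1, -, hP1, hR1⟩ := hubbardStaggered_structure (d := d) t U (θ + Pi.single 0 δ)
  obtain ⟨hH2, -, hP2, hR2⟩ := hubbardStaggered_structure (d := d) t U (θ + Pi.single 0 (-δ))
  have hNq : ∀ i : Fin d, (evenPeriods d i + 1) ∣ N := fun _ => hN2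
  have hL := FermionInteraction.le_perVarPressure_of_le_log_partitionFn hd hH0 hE0 hP0 hR0 β hN hNq hℓ
  have hUp := FermionInteraction.perVarPressure_le_of_log_partitionFn_le hd hH1 hP1 hR1 β hN hNq hup
  have hUm := FermionInteraction.perVarPressure_le_of_log_partitionFn_le hd hH2 hP2 hR2 β hN hNq hum
  rw [hubbardStaggered_empty_re, mul_zero, add_zero] at hL hUp hUm
  have h' : ω.IsPerVarEquilibrium β (evenPeriods d)
      (FermionInteraction.linearFamily (hubbardFermionInteraction d t U) ![numberInteraction d, staggeredSpinInteraction d] θ) 1 := h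
  have hw := FermionInteraction.IsPerVarEquilibrium.cellMeanEnergy_mem_Icc_of_bounds hβ h' 0 hδ hL hUp hUm
  rwa [show (![numberInteraction d, staggeredSpinInteraction d] : Fin 2 → FermionInteraction d) 0 = numberInteraction d from rfl,
    cellMeanEnergy_numberInteraction] at hw

end InfVolFermionState

end Literature.MathematicalPhysics.QuantumLattice

end
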